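import Summits.CriticalPhenomena.PercolationContinuityZ3.Theorems.SahiMasterFamilyOrShapeDomination

/-!
# The OR-shape at every order, IV: the merged hypothesis in labelling form (block families ↔ surjective labellings)

Unit `prim-master-conj` (crux anchor stmt-CriticalPhenomena-4575, helper work), gen 17; memo
`run/shared/lean/prim/prim-l12/prim-master-conj/POINTWISE.md` §18.  Consumer-facing form of `OrShape.sahiE_orShape_dominates` (Part III).

The hypothesis of Part III quantifies over the block families `T` of all slots containing the block `{0}` and evaluates the tree's `sahiEOn`
on the universal merged family.  Here it is converted to the natural statement about MERGING BY A LABELLING: for every surjection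
`c : Fin (n+1) → Fin r` the family `(A⁰, (⋂_{j : c j = i} B_j)_{i<r})` has `E_{r+1}(μ_p; ·) ≥ 0` (`blockFamily_nonneg_of_labels`), whence
(`sahiE_orShape_dominates_of_labels`) **class (B) at every order** in labelling form:
`(1 − p_e)^{n+1}·E_{n+2}(μ_p; 1_{A⁰}, 1_B) ≤ E_{n+2}(μ_p; 1_A, (1_{B_j ∪ S_e})_j)` and the latter is `≥ 0`.
HONEST FRAMING: a closure statement; `C_k` / `MasterFamilyEqIff k` remain open in general.  Axioms standard. [this work]
-/

set_option autoImplicit false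

open Finset

open private mem_pre from Literature.Combinatorics.Sahi2008.CumulationCone

noncomputable section

open scoped Classical

namespace Summit.CriticalPhenomena.PercolationContinuityZ3.Theorems

namespace OrShape

open Function
open Literature.Combinatorics.Sahi2008
open Literature.Combinatorics.Sahi2008.SqFree
open Literature.Probability.Percolation.DecisionTree (ind ind_of_mem ind_of_not_mem ind_nonneg)

section Labels

variable {ι : Type} [Fintype ι] (μ : Set ι → ℝ) (e : ι) {n : ℕ} (A : Set (Set ι)) (B : Fin (n + 1) → Set (Set ι))

/-- In a block family of all slots containing the block `{0}`, every tail slot `j.succ` lies in exactly one block, and that block is not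
`{0}` and does not contain `0`. [this work] -/
theorem exists_unique_block {T : Finset (NEFinset (Fin (n + 2)))} (hT : T ∈ blockFamilies (univ : Finset (Fin (n + 2))))
    (h0 : (⟨{0}, singleton_nonempty 0⟩ : NEFinset (Fin (n + 2))) ∈ T) (j : Fin (n + 1)) :
    ∃ σ' ∈ T.erase ⟨{0}, singleton_nonempty 0⟩, j.succ ∈ σ'.1 ∧ (0 : Fin (n + 2)) ∉ σ'.1 ∧
      ∀ σ'' ∈ T, j.succ ∈ σ''.1 → σ'' = σ' := by
  obtain ⟨hdis, hcover⟩ := mem_blockFamilies.mp hT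
  have hj : j.succ ∈ T.biUnion Subtype.val := by rw [hcover]; exact mem_univ _
  obtain ⟨σ', hσ'T, hjσ'⟩ := Finset.mem_biUnion.mp hj
  have hne : σ' ≠ ⟨{0}, singleton_nonempty 0⟩ := by
    intro h; rw [h] at hjσ'
    exact Fin.succ_ne_zero j (Finset.mem_singleton.mp hjσ')
  refine ⟨σ', Finset.mem_erase.mpr ⟨hne, hσ'T⟩, hjσ', ?_, ?_⟩
  · intro h0σ'
    have hd := hdis σ' hσ'T _ h0 hne
    exact Finset.disjoint_left.mp hd h0σ' (Finset.mem_singleton_self 0)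
  · intro σ'' hσ''T hjσ''
    by_contra hne'
    exact Finset.disjoint_left.mp (hdis σ'' hσ''T σ' hσ'T hne') hjσ'' hjσ'

/-- **From block families to labellings.**  For every block family `T` of all slots containing the block `{0}` there is a surjective
labelling `c : Fin (n+1) → Fin r` (`r + 1 = |T|`) such that, under EVERY weight, the merged indicator functional of `T` is
`E_{r+1}(1_{A⁰}, (1_{⋂_{j : c j = i} B_j})_{i<r})`. [this work] -/
theorem exists_labels_eq (T : Finset (NEFinset (Fin (n + 2)))) (hT : T ∈ blockFamilies (univ : Finset (Fin (n + 2))))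
    (h0 : (⟨{0}, singleton_nonempty 0⟩ : NEFinset (Fin (n + 2))) ∈ T) :
    ∃ (r : ℕ) (c : Fin (n + 1) → Fin r), Function.Surjective c ∧ ∀ μ : Set ι → ℝ,
      sahiEOn μ T (fun (σ' : NEFinset (Fin (n + 2))) =>
        ind (if σ'.1 = {0} then secAt e false A else if (0 : Fin (n + 2)) ∈ σ'.1 then (∅ : Set (Set ι))
          else ⋂ j ∈ SqFree.pre σ'.1, B j)) =
      sahiE μ (r + 1) (Matrix.vecCons (ind (secAt e false A))
        (fun i => ind (⋂ j ∈ (univ : Finset (Fin (n + 1))).filter (fun j => c j = i), B j))) := by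
  set z0 : NEFinset (Fin (n + 2)) := ⟨{0}, singleton_nonempty 0⟩ with hz0
  set T' := T.erase z0 with hT'
  set r := T'.card with hr
  set e' : Fin r ≃ T' := T'.equivFin.symm with he'
  -- the labelling: `j ↦` the index of the block through `j.succ`
  have hblk := fun j : Fin (n + 1) => exists_unique_block hT h0 j
  set blk : Fin (n + 1) → T' := fun j => ⟨(hblk j).choose, (hblk j).choose_spec.1⟩ with hblk_def
  have hblk_mem : ∀ j, j.succ ∈ ((blk j : T') : NEFinset (Fin (n + 2))).1 := fun j => (hblk j).choose_spec.2.1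
  have hblk_uniq : ∀ j, ∀ σ'' ∈ T, j.succ ∈ σ''.1 → σ'' = ((blk j : T') : NEFinset (Fin (n + 2))) :=
    fun j => (hblk j).choose_spec.2.2.2
  set c : Fin (n + 1) → Fin r := fun j => e'.symm (blk j) with hc
  -- blocks of `T'` do not contain `0` and are not `{0}`
  have hT'0 : ∀ x : T', (0 : Fin (n + 2)) ∉ (x : NEFinset (Fin (n + 2))).1 ∧ (x : NEFinset (Fin (n + 2))).1 ≠ {0} := by
    intro x
    have hxT : (x : NEFinset (Fin (n + 2))) ∈ T := Finset.mem_of_mem_erase x.2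
    have hxne : (x : NEFinset (Fin (n + 2))) ≠ z0 := (Finset.mem_erase.mp x.2).1
    obtain ⟨hdis, _⟩ := mem_blockFamilies.mp hT
    constructor
    · intro hx0
      exact Finset.disjoint_left.mp (hdis _ hxT _ h0 hxne) hx0 (Finset.mem_singleton_self 0)
    · intro h; exact hxne (Subtype.ext h)
  -- the fibres of `c` are the blocks
  have hfib : ∀ i : Fin r, (univ : Finset (Fin (n + 1))).filter (fun j => c j = i) = SqFree.pre ((e' i : T') : NEFinset (Fin (n + 2))).1 := by
    intro i
    ext j
    rw [Finset.mem_filter, mem_pre]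
    simp only [Finset.mem_univ, true_and]
    constructor
    · intro hji
      have : blk j = e' i := by rw [← hji, hc]; simp
      rw [← this]; exact hblk_mem j
    · intro hj
      have hx := hblk_uniq j _ (Finset.mem_of_mem_erase (e' i).2) hj
      have : blk j = e' i := Subtype.ext hx.symm
      rw [hc]; simp [this]
  have hsurj : Function.Surjective c := by
    intro i
    obtain ⟨k, hk⟩ := ((e' i : T') : NEFinset (Fin (n + 2))).2
    have hk0 : k ≠ 0 := fun h => (hT'0 (e' i)).1 (h ▸ hk)
    obtain ⟨j, rfl⟩ := Fin.exists_succ_eq.mpr hk0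
    refine ⟨j, ?_⟩
    have hj : j ∈ (univ : Finset (Fin (n + 1))).filter (fun j => c j = i) := by rw [hfib i]; exact mem_pre.mpr hk
    exact (Finset.mem_filter.mp hj).2
  -- enumerate `T` : `0 ↦ {0}`, `i.succ ↦ e' i`
  have hcard : T.card = r + 1 := by rw [hr, hT', Finset.card_erase_add_one h0]
  set g : Fin (r + 1) → T := fun k => Fin.cases (⟨z0, h0⟩ : T) (fun i => ⟨(e' i : T'), Finset.mem_of_mem_erase (e' i).2⟩) k with hg
  have hg_bij : Function.Bijective g := by
    constructor
    · intro k k' hkk'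
      induction k using Fin.cases with
      | zero =>
        induction k' using Fin.cases with
        | zero => rfl
        | succ i' =>
          exfalso
          have h := congrArg Subtype.val hkk'
          simp only [hg, Fin.cases_zero, Fin.cases_succ] at h
          exact (hT'0 (e' i')).2 (congrArg Subtype.val h).symm
      | succ i =>
        induction k' using Fin.cases with
        | zero =>
          exfalso
          have h := congrArg Subtype.val hkk'
          simp only [hg, Fin.cases_zero, Fin.cases_succ] at h
          exact (hT'0 (e' i)).2 (congrArg Subtype.val h)
        | succ i' =>
          have h := congrArg Subtype.val hkk'
          simp only [hg, Fin.cases_succ] at h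
          rw [e'.injective (Subtype.ext h)]
    · rintro ⟨x, hx⟩
      by_cases hx0 : x = z0
      · exact ⟨0, Subtype.ext (by simp [hg, hx0])⟩
      · have hx' : x ∈ T' := Finset.mem_erase.mpr ⟨hx0, hx⟩
        refine ⟨(e'.symm ⟨x, hx'⟩).succ, Subtype.ext ?_⟩
        simp [hg]
  set eT : Fin T.card ≃ T := (finCongr hcard).trans (Equiv.ofBijective g hg_bij) with heT
  refine ⟨r, c, hsurj, fun μ => ?_⟩
  rw [← sahiE_comp_equiv_eq_sahiEOn μ T _ eT]
  have hfam : (fun k : Fin T.card => (fun (σ' : NEFinset (Fin (n + 2))) =>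
      ind (if σ'.1 = {0} then secAt e false A else if (0 : Fin (n + 2)) ∈ σ'.1 then (∅ : Set (Set ι))
        else ⋂ j ∈ SqFree.pre σ'.1, B j)) ((eT k : T) : NEFinset (Fin (n + 2)))) =
      fun k => (Matrix.vecCons (ind (secAt e false A))
        (fun i => ind (⋂ j ∈ (univ : Finset (Fin (n + 1))).filter (fun j => c j = i), B j)) : Fin (r + 1) → Set ι → ℝ)
        (Fin.cast hcard k) := by
    funext k
    simp only [heT, Equiv.trans_apply, finCongr_apply, Equiv.ofBijective_apply]
    generalize Fin.cast hcard k = k'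
    induction k' using Fin.cases with
    | zero => simp [hg, hz0]
    | succ i =>
      simp only [hg, Fin.cases_succ, Matrix.cons_val_succ]
      rw [if_neg (hT'0 (e' i)).2, if_neg (hT'0 (e' i)).1, hfib i]
  rw [hfam, SahiTotalCumulance.sahiE_cast' μ hcard]

/-- **From labellings to block families (positivity).**  If every merged family `(A⁰, (⋂_{j : c j = i} B_j)_{i<r})` given by a surjective
labelling has Sahi functional `≥ 0` under `μ`, then so does the universal merged family on every block family of all slots containing the
block `{0}` (the hypothesis of `sahiE_orShape_dominates`). [this work] -/
theorem blockFamily_nonneg_of_labels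
    (Hmap : ∀ (r : ℕ) (c : Fin (n + 1) → Fin r), Function.Surjective c →
      0 ≤ sahiE μ (r + 1) (Matrix.vecCons (ind (secAt e false A))
        (fun i => ind (⋂ j ∈ (univ : Finset (Fin (n + 1))).filter (fun j => c j = i), B j))))
    (T : Finset (NEFinset (Fin (n + 2)))) (hT : T ∈ blockFamilies (univ : Finset (Fin (n + 2))))
    (h0 : (⟨{0}, singleton_nonempty 0⟩ : NEFinset (Fin (n + 2))) ∈ T) :
    0 ≤ sahiEOn μ T (fun (σ' : NEFinset (Fin (n + 2))) =>
      ind (if σ'.1 = {0} then secAt e false A else if (0 : Fin (n + 2)) ∈ σ'.1 then (∅ : Set (Set ι))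
        else ⋂ j ∈ SqFree.pre σ'.1, B j)) := by
  obtain ⟨r, c, hc, h⟩ := exists_labels_eq e A B T hT h0
  rw [h μ]
  exact Hmap r c hc

/-- **CLASS (B) AT EVERY ORDER, labelling form.**  `A` increasing, `B_0,…,B_n` `e`-free events; if for every surjective labelling
`c : Fin (n+1) → Fin r` the merged family `(A⁰, (⋂_{j : c j = i} B_j)_{i<r})` has `E_{r+1}(μ_p; ·) ≥ 0`, then
`(1 − p_e)^{n+1}·E_{n+2}(μ_p; 1_{A⁰}, 1_{B_0},…,1_{B_n}) ≤ E_{n+2}(μ_p; 1_A, 1_{B_0 ∪ S_e},…,1_{B_n ∪ S_e})` and the latter is `≥ 0`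
("OR `{e∈ω}` into all members but one" preserves Sahi positivity given the merged lower data). [this work] -/
theorem sahiE_orShape_dominates_of_labels (p : ι → unitInterval) (hA : IsUpperSet A) (hB : ∀ j (b : Bool), secAt e b (B j) = B j)
    (Hmap : ∀ (r : ℕ) (c : Fin (n + 1) → Fin r), Function.Surjective c →
      0 ≤ sahiE (bernoulliWeight p) (r + 1) (Matrix.vecCons (ind (secAt e false A))
        (fun i => ind (⋂ j ∈ (univ : Finset (Fin (n + 1))).filter (fun j => c j = i), B j)))) :
    (1 - (p e : ℝ)) ^ (n + 1) * sahiE (bernoulliWeight p) (n + 2) (Matrix.vecCons (ind (secAt e false A)) (fun j => ind (B j))) ≤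
        sahiE (bernoulliWeight p) (n + 2) (Matrix.vecCons (ind A) (fun j => ind (B j ∪ {ω' : Set ι | e ∈ ω'}))) ∧
      0 ≤ sahiE (bernoulliWeight p) (n + 2) (Matrix.vecCons (ind A) (fun j => ind (B j ∪ {ω' : Set ι | e ∈ ω'}))) :=
  sahiE_orShape_dominates p e A B hA hB (blockFamily_nonneg_of_labels (bernoulliWeight p) e A B Hmap)

end Labels

end OrShape
end Summit.CriticalPhenomena.PercolationContinuityZ3.Theorems
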